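import Summits.ResolutionOfSingularities.ResolutionOfSingularities.Theorems.HilbertSamuelEliminationSigmaMaxModificationsCorridor3WLadderStrataCentreCurveDominantClean
import Summits.ResolutionOfSingularities.ResolutionOfSingularities.Theorems.HilbertSamuelEliminationSigmaMaxModificationsCorridor3WLadderMovingTwo
import Summits.ResolutionOfSingularities.ResolutionOfSingularities.Theorems.HilbertSamuelEliminationSigmaMaxModificationsCorridor3WLadderRationalNearStep
import Literature.AlgebraicGeometry.Resolution.DirectrixSchemeLocal
import Literature.AlgebraicGeometry.Resolution.RegularLocalRingsProofs
import Summits.ResolutionOfSingularities.ResolutionOfSingularities.Theorems.HilbertSamuelEliminationSigmaMaxModificationsCorridor3WLadderStrataRowCensus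
import HarnessLib

/-!
# [OURS · L1 W4.2] ROW (K-ctr-cv) `StrataCurveCentreDominantClean p 3 (QNe Q) (ē ≤ 2)` FOR EVERY ORIGIN PREDICATE `Q` — the (F1♯) /
# β-twin of res-D-pv-038's p527476, modulo the (F1♯) binders `Theorem314_geomDir`, `Thm314_point_locus_geomDir` and the printed
# characteristic-free CJS Thm. 3.6; with P-b's print door re-keyed to `GeomDirHypothesis`

Crux chain w42 (`SigmaMaxModifications`, stmt-ResolutionOfSingularities-18506; conjunct stmt-ResolutionOfSingularities-19249), seat
res-L1-w42-stub-4 (gen 4; strata half / β-twin `WlowStrataM p`, stub-3's socket `hS`). OURS (cell res-hironaka, slot W4.2); NOT statements of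
H. Hironaka's manuscript [Hironaka2017] nor of [CossartJannsenSaito2020]; AI-drafted, weaker than expert review. Pure proofs (no definition);
binders BY NAME — the OURS (F1♯) claims `Theorem314_geomDir`, `Thm314_point_locus_geomDir` (stub-3, `…MovingTwoDefs`; not citations of print)
and the printed `CossartJannsenSaito2020_thm_3_6` (F-65; a theorem from F-64 by res-type-064's `CossartJannsenSaito2020_thm_3_6_of_thm_3_7`).
Helper file `--supports stmt-ResolutionOfSingularities-19249`.

* §1 res-L1-s42-pv-1's P-b print door (`…CampaignW42ProjDirLineRelative`, `…NearPointRationalBinder`: near points over a NON-closed point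
  `y` of the centre with `𝓘_{D,y} = 𝔪_y` and `e_y = 1` are at most one, `κ(y)`-rational, on `ℙ(Dir_y)`, by base change to `Spec 𝒪_{X,y}`)
  RE-KEYED from (F1) `CharHypothesis` to (F1♯) `GeomDirHypothesis` (`geomDirHypothesis_spec_stalk`: `ē` and the residue characteristic
  are the same at the closed point of `Spec 𝒪_{X,y}`): `isOnProjDirectrix_of_near_of_geomDirHypothesis`,
  `nearFibre_subsingleton_of_geomDirHypothesis(')`, `isIso_residueFieldMap_of_near_of_geomDirHypothesis`.
* §2 `geomDirDim_le_two_of_specializes` («`ē_η ≤ dim 𝒪_η < dim 𝒪_x ≤ dim X ≤ 3`» for `η ⤳ x`, `η ≠ x`) and the row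
  **`strataCurveCentreDominantClean_of_geomDir : Theorem314_geomDir → Thm314_point_locus_geomDir → CossartJannsenSaito2020_thm_3_6 →
  ∀ Q, StrataCurveCentreDominantClean p 3 (QNe Q) (ē ≤ 2)`**.
* §3 with this seat's census (`…StrataRowCensus`, p527465): **`wlowStrataM_of_geomDir_printedFacts : Theorem314_geomDir →
  Theorem314_nearFibre_geomDir → Thm314_point_locus_geomDir → LocalChainPrintedFacts → CossartJannsenSaito2020_thm_3_6 → ∀ p, WlowStrataM p`**
  — the β-twin strata row (stub-3's socket `hS`) with NO OURS CONSTRUCTION left (three (F1♯) claims + seven printed facts); the `Q`-generic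
  row; and **`wlow3TwoM_census_printedFacts`** — stub-3's `wlow3TwoM_census` with BOTH strata sockets discharged: `∀ p, p.Prime → Wlow3TwoM p`
  from printed facts, the OURS claims (R_β) `KeyTheorem640_localized_isolated` / `Corollary637_geomDir`, the (F1♯) shadows `Theorem314_geomDir` /
  `Theorem314_nearFibre_geomDir`, and ONE OURS construction: unit recognition `Seg.UnitRecognitionAtQM 2 ⊤`.

References: CJS LNM 2270 Thm. 3.6, Thm. 3.14, Def. 6.34 (i), Rem. 6.29 (1), (6.24), p. 103, p. 104, p. 107 [CossartJannsenSaito2020]; Stacks 01J7,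
02IZ [StacksProject]; tree p527476 / p526576 (res-D-pv-038), p522235 / `…ProjDirLineRelative` (res-L1-s42-pv-1), p522551 (this seat).
-/

noncomputable section

-- plan-1/idea-2 module setting kept (namespace `…Corridor3.Moving` re-enters `…Corridor3`)
set_option linter.dupNamespace false

open CategoryTheory CategoryTheory.Limits AlgebraicGeometry TopologicalSpace Topology IsLocalRing
open Summit.ResolutionOfSingularities.ResolutionOfSingularities.Theorems.CampaignW42
open Literature.AlgebraicGeometry.Resolution Literature.RingTheory.HilbertSamuel
open Literature.AlgebraicGeometry.CossartJannsenSaito2020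
open Summit.ResolutionOfSingularities.ResolutionOfSingularities.Theorems.SigmaMaxModificationsCorridor3
open Scheme.IdealSheafData

universe u

namespace Summit.ResolutionOfSingularities.ResolutionOfSingularities.Theorems.SigmaMaxModificationsCorridor3.Moving

/-! ## §1. P-b's print door re-keyed to (F1♯) -/

section Door

variable {X X' : Scheme.{u}} [IsLocallyNoetherian X] {π : X' ⟶ X} {C : Closeds X} {y : X}

omit [IsLocallyNoetherian X] in
/-- **(F1♯) transfers to the closed point of `Spec 𝒪_{W,x}`**: same residue characteristic (`Helpers.ringChar_residueField_eq_of_hom'`) and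
same `ē` (`Scheme.geomDirDim_fromSpecStalk_closedPoint`). [cite: CossartJannsenSaito2020, Def. 2.26, p. 107] -/
theorem geomDirHypothesis_spec_stalk {W : Scheme.{u}} [IsLocallyNoetherian W] {x : W} (h : GeomDirHypothesis W x) :
    GeomDirHypothesis (Spec (W.presheaf.stalk x)) (closedPoint (W.presheaf.stalk x)) := by
  have hκ : ringChar (ResidueField ((Spec (W.presheaf.stalk x)).presheaf.stalk (closedPoint (W.presheaf.stalk x)))) =
      ringChar (ResidueField (W.presheaf.stalk x)) := by
    have h1 := Helpers.ringChar_residueField_eq_of_hom' (W.fromSpecStalk x) (closedPoint (W.presheaf.stalk x))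
    rw [Scheme.fromSpecStalk_closedPoint] at h1
    exact h1
  unfold GeomDirHypothesis at h ⊢
  rw [hκ, Scheme.geomDirDim_fromSpecStalk_closedPoint]
  exact h

/-- **Near points over `y` lie on `ℙ(Dir_y)` — (F1♯) door**, modulo the OURS point-centre binder `Thm314_point_locus_geomDir`, transferred
to the (non-closed) point `y` through the local blow-up (res-L1-s42-pv-1's `isOnProjDirectrix_of_near_of_charHypothesis` re-keyed): `X`
excellent with `dim X ≤ N`, `(Spec 𝒪_{X,y} → X)⁻¹(C) = {𝔪_y}`, `GeomDirHypothesis X y`, `1 ≤ e_y(X)`, `x'` over `y` near at level `N`.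
[cite: CossartJannsenSaito2020, Thm. 3.14, p. 104, p. 107] -/
theorem isOnProjDirectrix_of_near_of_geomDirHypothesis (h314 : Thm314_point_locus_geomDir.{u}) (hX : Scheme.IsExcellent X)
    {N : ℕ} (hN : topologicalKrullDim ↥X ≤ (N : WithBot ℕ∞)) (hπ : IsBlowup π (vanishingIdeal C))
    (hCy : (X.fromSpecStalk y).base ⁻¹' (C : Set X) = {closedPoint (X.presheaf.stalk y)}) (hgdh : GeomDirHypothesis X y)
    (he1 : 1 ≤ Scheme.dirDim X y) {x' : X'} (hx' : π.base x' = y) (hnear : Scheme.hsFun X' N x' = Scheme.hsFun X N y) :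
    IsOnProjDirectrix π x' := by
  have hcl := isClosed_singleton_closedPoint_stalk y
  have hloc := isBlowup_pullback_snd_fromSpecStalk π y hπ hCy hcl
  obtain ⟨s, hs, hspt⟩ := exists_pullback_fst_eq_of_eq π y hx'
  have hnear' : Scheme.hsFun (pullback π (X.fromSpecStalk y)) N s =
      Scheme.hsFun (Spec (X.presheaf.stalk y)) N (closedPoint (X.presheaf.stalk y)) := by
    haveI : IsLocallyNoetherian X' := by
      haveI : IsProper π := hπ.isProper
      exact LocallyOfFiniteType.isLocallyNoetherian π
    rw [hsFun_pullback_eq_iff π y N s, hs]; exact hnear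
  have hon : IsOnProjDirectrix (pullback.snd π (X.fromSpecStalk y)) s :=
    h314 _ _ (pullback.snd π (X.fromSpecStalk y)) _ hcl N s (isExcellent_Spec_stalk y hX)
      (isPermissible_vanishingIdeal_closedPoint y (ringKrullDim_stalk_pos_of_one_le_dirDim he1)) hloc
      ((topologicalKrullDim_Spec_stalk_le y).trans hN) hspt (geomDirHypothesis_spec_stalk hgdh) hnear'
  rw [isOnProjDirectrix_pullback_iff π y s, hs] at hon
  exact hon

/-- **P-b, (F1♯) DOOR.** `π : X' → X` a blow-up of the excellent locally noetherian `X` (`dim X ≤ N`) in the closed `C` (reduced), `y` a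
point with `(Spec 𝒪_{X,y} → X)⁻¹(C) = {𝔪_y}`, `GeomDirHypothesis X y` and `e_y(X) = 1`: the points of `X'` over `y` NEAR to `y` form a
SUBSINGLETON, and such a point is `κ(y)`-RATIONAL and lies on `ℙ(Dir_y(X))` (CJS p. 104 «at most one point `η_2` near to `η_1` …
`k(η_1) = k(η_2)`»), modulo `Thm314_point_locus_geomDir`. [cite: CossartJannsenSaito2020, p. 104, Thm. 3.14, Def. 6.34 (i)] -/
theorem nearFibre_subsingleton_of_geomDirHypothesis (h314 : Thm314_point_locus_geomDir.{u}) (hX : Scheme.IsExcellent X) {N : ℕ}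
    (hN : topologicalKrullDim ↥X ≤ (N : WithBot ℕ∞)) (hπ : IsBlowup π (vanishingIdeal C))
    (hCy : (X.fromSpecStalk y).base ⁻¹' (C : Set X) = {closedPoint (X.presheaf.stalk y)}) (hgdh : GeomDirHypothesis X y)
    (he : Scheme.dirDim X y = 1) :
    {x' : X' | π.base x' = y ∧ Scheme.hsFun X' N x' = Scheme.hsFun X N y}.Subsingleton ∧
      ∀ x' : X', π.base x' = y → Scheme.hsFun X' N x' = Scheme.hsFun X N y →
        IsIso (π.residueFieldMap x') ∧ IsOnProjDirectrix π x' := by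
  obtain ⟨hsub, hrat⟩ := projDirectrixFibre_subsingleton_of_dirDim_eq_one hπ hCy he
  have hon : ∀ x' : X', π.base x' = y → Scheme.hsFun X' N x' = Scheme.hsFun X N y → IsOnProjDirectrix π x' :=
    fun x' hx' hnear => isOnProjDirectrix_of_near_of_geomDirHypothesis h314 hX hN hπ hCy hgdh (by omega) hx' hnear
  refine ⟨fun x₁ hx₁ x₂ hx₂ => hsub ⟨hx₁.1, hon x₁ hx₁.1 hx₁.2⟩ ⟨hx₂.1, hon x₂ hx₂.1 hx₂.2⟩, fun x' hx' hnear => ?_⟩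
  exact ⟨hrat x' ⟨hx', hon x' hx' hnear⟩, hon x' hx' hnear⟩

end Door

/-- **(B4♯), binder shape** (res-L1-s42-pv-1's `isIso_residueFieldMap_of_near_of_charHypothesis` re-keyed): residual rationality of the near
point over a point `y = π x'` of a permissible centre with `𝓘_{D,y} = 𝔪_y`, (F1♯) and `e_y(X) = 1`, modulo `Thm314_point_locus_geomDir`.
[cite: CossartJannsenSaito2020, Thm. 3.14, Def. 6.34 (i), p. 104] -/
theorem isIso_residueFieldMap_of_near_of_geomDirHypothesis (h314 : Thm314_point_locus_geomDir.{u}) :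
    ∀ (X X' : Scheme.{u}) [IsLocallyNoetherian X] [IsLocallyNoetherian X'] (π : X' ⟶ X) (D : X.IdealSheafData),
      Scheme.IsExcellent X → IdealSheafData.IsPermissible D → IsBlowup π D →
        ∀ N : ℕ, topologicalKrullDim ↥X ≤ (N : WithBot ℕ∞) →
          ∀ x' : X', π.base x' ∈ (D.support : Set X) →
            stalkIdeal D (π.base x') = maximalIdeal (X.presheaf.stalk (π.base x')) → GeomDirHypothesis X (π.base x') →
              Scheme.dirDim X (π.base x') = 1 → Scheme.hsFun X' N x' = Scheme.hsFun X N (π.base x') →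
                IsIso (π.residueFieldMap x') := by
  intro X X' _ _ π D hX hD hπ N hN x' _ hDy hgdh he hnear
  exact ((nearFibre_subsingleton_of_geomDirHypothesis h314 hX hN (isBlowup_vanishingIdeal_support_of_isPermissible hD hπ)
    (preimage_support_fromSpecStalk_eq_singleton_of_stalkIdeal_eq hDy) hgdh he).2 x' rfl hnear).1

/-- **(B4♯) UNIQUENESS companion, binder shape**: the points over `y` near to `y` form a subsingleton ((F1♯) at `y`, `e_y = 1`), modulo
`Thm314_point_locus_geomDir`. [cite: CossartJannsenSaito2020, Thm. 3.14, p. 104] -/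
theorem nearFibre_subsingleton_of_geomDirHypothesis' (h314 : Thm314_point_locus_geomDir.{u}) :
    ∀ (X X' : Scheme.{u}) [IsLocallyNoetherian X] [IsLocallyNoetherian X'] (π : X' ⟶ X) (D : X.IdealSheafData),
      Scheme.IsExcellent X → IdealSheafData.IsPermissible D → IsBlowup π D →
        ∀ N : ℕ, topologicalKrullDim ↥X ≤ (N : WithBot ℕ∞) →
          ∀ y : X, y ∈ (D.support : Set X) → stalkIdeal D y = maximalIdeal (X.presheaf.stalk y) → GeomDirHypothesis X y →
            Scheme.dirDim X y = 1 →
              {x' : X' | π.base x' = y ∧ Scheme.hsFun X' N x' = Scheme.hsFun X N y}.Subsingleton := by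
  intro X X' _ _ π D hX hD hπ N hN y _ hDy hgdh he
  exact (nearFibre_subsingleton_of_geomDirHypothesis h314 hX hN (isBlowup_vanishingIdeal_support_of_isPermissible hD hπ)
    (preimage_support_fromSpecStalk_eq_singleton_of_stalkIdeal_eq hDy) hgdh he).1

/-! ## §2. The row for every origin predicate -/

/-- **`ē_η ≤ 2`** for a strict generization `η ⤳ x`, `η ≠ x`, on a scheme of dimension `≤ 3`: `ē_η ≤ dim 𝒪_{X,η}` (CJS Def. 2.21),
`dim 𝒪_{X,η} < dim 𝒪_{X,x}` (coheights in the specialisation order, Stacks 02IZ) and `dim 𝒪_{X,x} ≤ dim X ≤ 3`.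
[cite: CossartJannsenSaito2020, Def. 2.21] [cite: StacksProject, Tag 02IZ] -/
theorem geomDirDim_le_two_of_specializes {W : Scheme.{u}} [IsLocallyNoetherian W] {η x : W} (h : η ⤳ x) (hne : η ≠ x)
    (hW : topologicalKrullDim ↥W ≤ ((3 : ℕ) : WithBot ℕ∞)) : Scheme.geomDirDim W η ≤ 2 := by
  have hlt : ringKrullDim (W.presheaf.stalk η) < ringKrullDim (W.presheaf.stalk x) := by
    rw [ringKrullDim_stalk_eq_coheight, ringKrullDim_stalk_eq_coheight]
    have hxy : x < η := by
      refine lt_of_le_not_ge (Scheme.le_iff_specializes.mpr h) fun h' => hne ?_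
      exact (h.antisymm (Scheme.le_iff_specializes.mp h')).eq
    have hfin : Order.coheight η < ⊤ := by
      have h1 := ringKrullDim_lt_top (R := W.presheaf.stalk η)
      rw [ringKrullDim_stalk_eq_coheight] at h1
      by_contra htop
      rw [not_lt, top_le_iff] at htop
      rw [htop] at h1
      exact lt_irrefl _ h1
    exact_mod_cast Order.coheight_strictAnti hxy hfin
  have hx : ringKrullDim (W.presheaf.stalk x) ≤ ((3 : ℕ) : WithBot ℕ∞) := (ringKrullDim_stalk_le_topologicalKrullDim W x).trans hW
  have hē := Scheme.natCast_geomDirDim_le_ringKrullDim_stalk (X := W) η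
  obtain ⟨dη, hdη⟩ := ringKrullDim_eq_nat (W.presheaf.stalk η)
  obtain ⟨dx, hdx⟩ := ringKrullDim_eq_nat (W.presheaf.stalk x)
  rw [hdη] at hlt hē
  rw [hdx] at hlt hx
  have h1 : dη < dx := by exact_mod_cast hlt
  have h2 : dx ≤ 3 := by exact_mod_cast hx
  have h3 : Scheme.geomDirDim W η ≤ dη := by exact_mod_cast hē
  omega

variable {R : ∀ S : Scheme.{u}, CentreSeq S → Prop} {N : ℕ} {ν : ℕ → ℕ}

/-- **ROW (K-ctr-cv) FOR EVERY ORIGIN PREDICATE, (F1♯) form**: `StrataCurveCentreDominantClean p 3 (QNe Q) (ē ≤ 2)` from the (F1♯)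
binders `Theorem314_geomDir` (numerical Thm. 3.14 with `GeomDirHypothesis`), `Thm314_point_locus_geomDir` (point-centre locus form with
`GeomDirHypothesis`) and the printed, characteristic-free CJS Thm. 3.6 (`CossartJannsenSaito2020_thm_3_6`, F-65). res-D-pv-038's proof
(p527476) verbatim, with (F1) at `x_n` replaced by «`ē_{x_n} ≤ 2`» (the grade) and (F1) at the generic point `η` of `D` by
«`ē_η ≤ dim 𝒪_{X_n,η} ≤ 2`». [cite: CossartJannsenSaito2020, Thm. 3.14, Thm. 3.6, Rem. 6.29 (1), p. 104] -/
theorem strataCurveCentreDominantClean_of_geomDir {p : ℕ} (hF : Theorem314_geomDir.{u})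
    (h314p : Thm314_point_locus_geomDir.{u}) (h36 : CossartJannsenSaito2020_thm_3_6.{u})
    (Q : ℕ → (ℕ → ℕ) → ∀ X : Scheme.{u}, X → Prop) :
    StrataCurveCentreDominantClean.{u} p 3 (QNe Q) fun s => s.geomDirDim ≤ 2 := by
  intro R hRf hRa ν X _ x hX hQ c h0 hstep hG hnI hmov
  refine ⟨0, fun n _ C P' hcs f hf D hD hxD hDne => ?_⟩
  obtain ⟨-, hν⟩ := hQ
  obtain ⟨-, k, _, hinv⟩ := exists_cycleInv_chain' hRf hRa hX h0 hstep
  -- standing facts at stage `n`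
  haveI : IsLocallyNoetherian (c n).W := (c n).ln
  haveI : IsLocallyNoetherian (c (n + 1)).W := (c (n + 1)).ln
  haveI : IsNoetherian (c n).W := (hinv n).isNoetherian
  have hexc : Scheme.IsExcellent (c n).W := (hinv n).isExcellent
  have hdimW : topologicalKrullDim (c n).W ≤ ((3 : ℕ) : WithBot ℕ∞) := (hinv n).dim_le
  -- (F1♯) at the chain point: automatic at `ē ≤ 2`
  have hgdx : GeomDirHypothesis (c n).W (c n).pt := geomDirHypothesis_of_geomDirDim_le_two (hG n)
  obtain ⟨hCreg, hCstr, hCperm, -⟩ := (hinv n).centre hRa hν hcs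
  have hptcl : IsClosed ({(c n).pt} : Set (c n).W) := Reaches.isClosed_pt hX.isClosed (reaches_chain h0 hstep n)
  have hptcl' : IsClosed ({(c (n + 1)).pt} : Set (c (n + 1)).W) :=
    Reaches.isClosed_pt hX.isClosed (reaches_chain h0 hstep (n + 1))
  have hptν : (c n).pt ∈ Scheme.hsStratum (c n).W 3 ν := pt_mem_hsStratum_of_reaches hX.mem_stratum (reaches_chain h0 hstep n)
  have hptν' : (c (n + 1)).pt ∈ Scheme.hsStratum (c (n + 1)).W 3 ν :=
    pt_mem_hsStratum_of_reaches hX.mem_stratum (reaches_chain h0 hstep (n + 1))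
  have hWc' : IsClosed (Scheme.hsStratum (c (n + 1)).W 3 ν) := (hinv (n + 1)).isClosed_hsStratum
  have hfpt : f.base (c (n + 1)).pt = (c n).pt := hf.base_pt
  -- `f` is the blow-up in `C`
  have hbl : IsBlowup f C := by
    obtain ⟨C₂, P₂, h₂, x', hcs₂, -, -, -, e, hfe⟩ := hf
    obtain rfl : C₂ = C := hcs₂.centre_unique hRf hcs
    rw [hfe]
    exact (blowup.isBlowup C₂).iso_comp (eqToIso (congrArg MarkedStage.W e))
  -- `D`: closed irreducible inside `V(C)`, generic point `η ⤳ x_n`, `η ≠ x_n`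
  have hCcl : IsClosed (C.support : Set (c n).W) := C.support.isClosed
  have hDc : IsClosed D := componentsIn.isClosed hCcl hD
  have hDirr : IsIrreducible D := componentsIn.isIrreducible hD
  have hDC : D ⊆ (C.support : Set (c n).W) := componentsIn.subset hD
  obtain ⟨η, hη⟩ : ∃ η, IsGenericPoint η D := ⟨_, hDirr.isGenericPoint_genericPoint hDc⟩
  have hηx : η ⤳ (c n).pt := hη.specializes hxD
  have hηC : η ∈ (C.support : Set (c n).W) := hDC hη.mem
  have hxC : (c n).pt ∈ (C.support : Set (c n).W) := hDC hxD
  have hηne : η ≠ (c n).pt := fun h => hDne (by rw [← hη.def, h, hptcl.closure_eq])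
  have hην : Scheme.hsFun (c n).W 3 η = ν := Scheme.mem_hsStratum_iff.mp (hCstr hηC)
  -- (F1♯) at `η`: `ē_η ≤ dim 𝒪_{X_n,η} ≤ dim 𝒪_{X_n,x_n} − 1 ≤ 2`
  have hgdη : GeomDirHypothesis (c n).W η :=
    geomDirHypothesis_of_geomDirDim_le_two (geomDirDim_le_two_of_specializes hηx hηne hdimW)
  -- `I(D) = C` stalkwise on `D`; `C_η = 𝔪_η`; `𝓘(D)` permissible
  have hIDx : stalkIdeal (Scheme.IdealSheafData.vanishingIdeal ⟨D, hDc⟩) (c n).pt = stalkIdeal C (c n).pt :=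
    stalkIdeal_vanishingIdeal_eq_of_mem_componentsIn hCreg hCperm hD hDc hxD
  have hCη : stalkIdeal C η = maximalIdeal ((c n).W.presheaf.stalk η) := by
    rw [← stalkIdeal_vanishingIdeal_eq_of_mem_componentsIn hCreg hCperm hD hDc hη.mem]
    have hDcl : (⟨D, hDc⟩ : Closeds (c n).W) = ⟨closure {η}, isClosed_closure⟩ := Closeds.ext hη.def.symm
    rw [hDcl, stalkIdeal_vanishingIdeal_closure_self]
  have hDcl : (⟨closure ({η} : Set (c n).W), isClosed_closure⟩ : Closeds (c n).W) = ⟨D, hDc⟩ := Closeds.ext hη.def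
  have hpermD : IdealSheafData.IsPermissible (Scheme.IdealSheafData.vanishingIdeal ⟨closure ({η} : Set (c n).W), isClosed_closure⟩) := by
    rw [hDcl]; exact isPermissible_vanishingIdeal_of_mem_componentsIn hCreg hCperm hD hDc
  -- `A := 𝒪_{x_n}/C_{x_n}` is regular of dimension `1`
  haveI hregA : IsRegularLocalRing ((c n).W.presheaf.stalk (c n).pt ⧸ stalkIdeal C (c n).pt) :=
    isRegularLocalRing_stalk_quotient_stalkIdeal hCreg hxC
  have hge1 : (1 : WithBot ℕ∞) ≤ ringKrullDim ((c n).W.presheaf.stalk (c n).pt ⧸ stalkIdeal C (c n).pt) :=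
    one_le_ringKrullDim_quotient_stalkIdeal C hηx hηne hηC
  have he2 : Scheme.dirDim (c n).W (c n).pt ≤ 2 := (Scheme.dirDim_le_geomDirDim (c n).pt).trans (hG n)
  have hlt : ringKrullDim ((c n).W.presheaf.stalk (c n).pt ⧸ stalkIdeal C (c n).pt) <
      (Scheme.dirDim (c n).W (c n).pt : WithBot ℕ∞) := by
    have hnear : Scheme.hsFun (c (n + 1)).W 3 (c (n + 1)).pt = Scheme.hsFun (c n).W 3 (c n).pt := by
      rw [Scheme.mem_hsStratum_iff.mp hptν', Scheme.mem_hsStratum_iff.mp hptν]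
    exact hF (c n).W (c (n + 1)).W f C 3 (c (n + 1)).pt (c n).pt hexc hCperm hbl hdimW hfpt hxC hgdx hnear
  obtain ⟨dA, hdA⟩ := ringKrullDim_eq_nat ((c n).W.presheaf.stalk (c n).pt ⧸ stalkIdeal C (c n).pt)
  have hdimA : ringKrullDim ((c n).W.presheaf.stalk (c n).pt ⧸ stalkIdeal C (c n).pt) = 1 := by
    rw [hdA] at hge1 hlt ⊢
    have h1 : 1 ≤ dA := by exact_mod_cast hge1
    have h2 : dA < Scheme.dirDim (c n).W (c n).pt := by exact_mod_cast hlt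
    have : dA = 1 := by omega
    rw [this]; rfl
  -- `e_η ≤ 1` (Thm. 3.6 at `η ⤳ x_n`)
  have heη1 : Scheme.dirDim (c n).W η ≤ 1 := by
    have h := h36 (c n).W hexc (c n).pt η hηx hpermD
    rw [hDcl, hIDx, hdimA] at h
    have h' : ((Scheme.dirDim (c n).W η + 1 : ℕ) : WithBot ℕ∞) ≤ ((Scheme.dirDim (c n).W (c n).pt : ℕ) : WithBot ℕ∞) := by
      push_cast; exact h
    have h'' : Scheme.dirDim (c n).W η + 1 ≤ Scheme.dirDim (c n).W (c n).pt := by exact_mod_cast h'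
    omega
  -- a dominant member: generic point `ζ′ ↦ η`, near to `η`; hence `e_η = 1`
  have member : ∀ Z' ∈ componentsThrough 3 ν (c (n + 1)), closure (f.base '' Z') = D →
      ∃ ζ', IsGenericPoint ζ' Z' ∧ f.base ζ' = η ∧
        Scheme.hsFun (c (n + 1)).W 3 ζ' = Scheme.hsFun (c n).W 3 (f.base ζ') ∧ Scheme.dirDim (c n).W η = 1 := by
    intro Z' hZ' hdom
    have hZ'c : IsClosed Z' := componentsIn.isClosed hWc' hZ'.1
    have hZ'irr : IsIrreducible Z' := componentsIn.isIrreducible hZ'.1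
    obtain ⟨ζ', hζ'⟩ : ∃ ζ', IsGenericPoint ζ' Z' := ⟨_, hZ'irr.isGenericPoint_genericPoint hZ'c⟩
    have hfζ : f.base ζ' = η := (hdom ▸ hζ'.image f.continuous).eq hη
    have hnear : Scheme.hsFun (c (n + 1)).W 3 ζ' = Scheme.hsFun (c n).W 3 (f.base ζ') := by
      rw [Scheme.mem_hsStratum_iff.mp (componentsIn.subset hZ'.1 hζ'.mem), hfζ, hην]
    refine ⟨ζ', hζ', hfζ, hnear, le_antisymm heη1 ?_⟩
    have h := hF (c n).W (c (n + 1)).W f C 3 ζ' η hexc hCperm hbl hdimW hfζ hηC hgdη (by rw [hnear, hfζ])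
    rw [hCη] at h
    have h0 : ringKrullDim ((c n).W.presheaf.stalk η ⧸ maximalIdeal ((c n).W.presheaf.stalk η)) = 0 := by
      letI := Ideal.Quotient.field (maximalIdeal ((c n).W.presheaf.stalk η))
      exact ringKrullDim_eq_zero_of_field _
    rw [h0] at h
    have : (0 : ℕ) < Scheme.dirDim (c n).W η := by exact_mod_cast h
    omega
  refine ⟨fun Z' hZ' Z'' hZ'' hd' hd'' => ?_, fun Z' hZ' hdom => ?_⟩
  · -- CLAUSE 1: at most one point of `X_{n+1}(ν)` over `η`
    obtain ⟨-, -, -, -, he1⟩ := member Z' hZ' hd'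
    have hsub := nearFibre_subsingleton_of_geomDirHypothesis' h314p (c n).W (c (n + 1)).W f C hexc hCperm hbl 3 hdimW η hηC hCη
      hgdη he1
    have hfibη : (Scheme.hsStratum (c (n + 1)).W 3 ν ∩ f.base ⁻¹' {η}).Subsingleton := by
      refine hsub.anti fun z hz => ⟨hz.2, ?_⟩
      rw [Scheme.mem_hsStratum_iff.mp hz.1, hην]
    exact dominant_unique_of_fibre_subsingleton f hη hWc' hfibη hZ'.1 hZ''.1 hd' hd''
  · -- CLAUSE 2: the DVR-domination core at the `k(η)`-rational near point `ζ′`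
    obtain ⟨ζ', hζ', hfζ, hnear, he1⟩ := member Z' hZ' hdom
    have hZ'c : IsClosed Z' := componentsIn.isClosed hWc' hZ'.1
    have hZ'irr : IsIrreducible Z' := componentsIn.isIrreducible hZ'.1
    have hne : Z' ≠ {(c (n + 1)).pt} := by
      intro h
      apply hDne
      rw [← hdom, h, Set.image_singleton, hfpt, hptcl.closure_eq]
    haveI : IsIso (f.residueFieldMap ζ') :=
      isIso_residueFieldMap_of_near_of_geomDirHypothesis h314p (c n).W (c (n + 1)).W f C hexc hCperm hbl 3 hdimW ζ'
        (hfζ ▸ hηC) (by rw [hfζ]; exact hCη) (by rw [hfζ]; exact hgdη) (by rw [hfζ]; exact he1) hnear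
    have hcl : (⟨closure (f.base '' Z'), isClosed_closure⟩ : Closeds (c n).W) = ⟨D, hDc⟩ := Closeds.ext hdom
    have hreg' : IsRegularLocalRing ((c n).W.presheaf.stalk (f.base (c (n + 1)).pt) ⧸
        stalkIdeal (Scheme.IdealSheafData.vanishingIdeal ⟨closure (f.base '' Z'), isClosed_closure⟩) (f.base (c (n + 1)).pt)) := by
      rw [hcl, hfpt, hIDx]; exact hregA
    have hdim' : ringKrullDim ((c n).W.presheaf.stalk (f.base (c (n + 1)).pt) ⧸
        stalkIdeal (Scheme.IdealSheafData.vanishingIdeal ⟨closure (f.base '' Z'), isClosed_closure⟩) (f.base (c (n + 1)).pt)) = 1 := by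
      rw [hcl, hfpt, hIDx]; exact hdimA
    exact isRegularCurveAt_of_dominant_of_isIso_residueFieldMap (c (n + 1)) f hptcl' hZ'irr hZ'c hZ'.2 hne hζ' hreg' hdim'

/-! ## §3. The β-twin strata row and the characteristic-2 census with (K-ctr-cv) discharged -/

/-- **The `Q`-generic strata row from the three (F1♯) binders, the printed bundle and Thm. 3.6** — no OURS construction.
[cite: CossartJannsenSaito2020, Thm. 3.6, Thm. 3.14, Def. 6.38 (ii), Rem. 6.29 (1)] -/
theorem maxOriginNoMovingNearChainAtQ_notIso_of_geomDir_printedFacts {p : ℕ}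
    {Q : ℕ → (ℕ → ℕ) → ∀ X : Scheme.{u}, X → Prop} (hF314 : Theorem314_geomDir.{u}) (hFf : Theorem314_nearFibre_geomDir.{u})
    (h314pt : Thm314_point_locus_geomDir.{u}) (hF : LocalChainPrintedFacts.{u}) (h36 : CossartJannsenSaito2020_thm_3_6.{u}) :
    MaxOriginNoMovingNearChainAtQ p 3 Q fun s => s.geomDirDim ≤ 2 ∧ ¬ Iso 3 s :=
  maxOriginNoMovingNearChainAtQ_notIso_of_geomDir_printedFacts_curveKernel hF314 hFf h314pt hF
    (strataCurveCentreDominantClean_of_geomDir hF314 h314pt h36 Q)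

/-- **β-twin: `WlowStrataM p` (stub-3's socket `hS`) FOR EVERY `p` from the three (F1♯) binders `Theorem314_geomDir`,
`Theorem314_nearFibre_geomDir`, `Thm314_point_locus_geomDir`, the printed bundle `LocalChainPrintedFacts` and the printed Thm. 3.6 — NO OURS
CONSTRUCTION left in the strata half.** [cite: CossartJannsenSaito2020, Thm. 3.6, Thm. 3.14, Def. 6.38 (ii), Thm. 6.35, Rem. 6.29 (1)] -/
theorem wlowStrataM_of_geomDir_printedFacts (hF314 : Theorem314_geomDir.{0}) (hFf : Theorem314_nearFibre_geomDir.{0})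
    (h314pt : Thm314_point_locus_geomDir.{0}) (hF : LocalChainPrintedFacts.{0}) (h36 : CossartJannsenSaito2020_thm_3_6.{0}) (p : ℕ) :
    WlowStrataM p :=
  wlowStrataM_of_geomDir_printedFacts_curveKernel hF314 hFf h314pt hF
    (strataCurveCentreDominantClean_of_geomDir hF314 h314pt h36 _)

/-- **THE CHARACTERISTIC-2 ROW `stub_Wlow3M_two`: ONE-STATEMENT CENSUS with BOTH strata sockets DISCHARGED (2026-08-27).** `∀ p, p.Prime →
Wlow3TwoM p` follows from: PRINTED — the bundle `LocalChainPrintedFacts` (Cor. 6.37 loc, Thm. 6.40 loc-iso, Thm. 3.14, Thm. 3.10 (4), Kollár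
1.101, Thm. 3.14 point locus), `CossartJannsenSaito2020_thm_3_6` (F-65), `ProjDir_line`, [H4] Th. IV `Hironaka1970_thmIV_point`, [H5] Th. 1 cor.
`Hironaka1970_thm1_cor`, Mizutani 2.8 `Mizutani1973_vectorGroup_of_dim_le`; OURS CLAIMS (R_β) — `KeyTheorem640_localized_isolated`,
`Corollary637_geomDir`; (F1♯) SHADOWS — `Theorem314_geomDir`, `Theorem314_nearFibre_geomDir` (`Thm314_point_locus_geomDir` is DERIVED, stub-2's
`thm314_point_locus_geomDir_of_sharp` over res-type-001's 2.14♯); ONE OURS CONSTRUCTION — unit recognition `Seg.UnitRecognitionAtQM 2 ⊤`.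
Plugs: stub-3's `wlow3TwoM_of_residue_loc`, stub-2's `isoE1BridgeFreeM_of_facts`, stub-1's `unitTowerExtractionLocFreeM_of_recognition`, §3.
CONDITIONAL — credits nothing. [cite: CossartJannsenSaito2020, Thm. 3.6, Thm. 3.10 (4), Thm. 3.14, Def. 6.34, Thm. 6.35, Cor. 6.37, Def. 6.38, Thm. 6.40] -/
theorem wlow3TwoM_census_printedFacts (hF : LocalChainPrintedFacts.{0}) (h36 : CossartJannsenSaito2020_thm_3_6.{0})
    (hline : ProjDir_line.{0}) (h14 : Hironaka1970_thmIV_point.{0})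
    (h15 : ∀ (q : ℕ) [Fact q.Prime], Literature.AlgebraicGeometry.Resolution.HironakaScheme.Hironaka1970_thm1_cor.{0} q)
    (h16 : ∀ (q : ℕ) [Fact q.Prime], Literature.AlgebraicGeometry.Resolution.HironakaScheme.Mizutani1973_vectorGroup_of_dim_le.{0} q)
    (hK : KeyTheorem640_localized_isolated.{0}) (hC : Corollary637_geomDir.{0})
    (hF314 : Theorem314_geomDir.{0}) (hFf : Theorem314_nearFibre_geomDir.{0})
    (hrec : Seg.UnitRecognitionAtQM 2 fun _ _ _ _ => True) : ∀ p : ℕ, p.Prime → Wlow3TwoM.{0} p :=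
  have h314gd : Thm314_point_locus_geomDir.{0} :=
    thm314_point_locus_geomDir_of_sharp (Directrix214Sharp.directrix_nearPoint_of_geomDirDim_le h14 h15 h16) hF.thm314_point_locus
  wlow3TwoM_of_residue_loc hK hC hF314 (isoE1BridgeFreeM_of_facts hF314 hF.2.2.2.1 h314gd hline 2)
    (unitTowerExtractionLocFreeM_of_recognition hrec) (wlowStrataM_of_geomDir_printedFacts hF314 hFf h314gd hF h36 2)

end Summit.ResolutionOfSingularities.ResolutionOfSingularities.Theorems.SigmaMaxModificationsCorridor3.Moving

end
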